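import Summits.QuantumFields.BalabanUV.Beta.FP.ScalarPropagatorProjection
import Summits.QuantumFields.BalabanUV.Beta.FP.CovarianceConstraintRowSum

/-!
# `BalabanUV.Beta.FP.CovarianceScalarLetters` — road «FP» (binder row D1), lane IR-5′, **THE (T0′) SUPPLIER CHAIN, FILE 4b: THE TWO COARSE-PROJECTED
# GRADIENT LETTERS `cA cB` FROM FOUR SCALAR LETTERS** — rows of `∂·Δ⁻¹·R`, `R·Δ⁻¹·∂ᴴ` ⇐ {`cG′ = ‖G′‖`, `cD = ‖G′∂ᴴ‖`, `cD′ = ‖∂G′‖`, `cC = ‖(Q′G′²Q′*)⁻¹‖`}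
# (`ℓ^∞ → ℓ^∞`, `G′ = (Δ + bQ′*Q′)⁻¹`) by (1.44) (`ScalarPropagatorProjection`), `‖Q′‖ = ‖Q′*‖ = 1`, and row-sum bookkeeping; hence the hard covariance's
# row-sum letter from those four scalar letters, `cG` (pv15) and `cC` (gan24) explicit (our bookkeeping; no estimate is proved here)

HONEST DEPENDENCY (page 1, mandatory): continuum YM on T⁴ ⇐ BetaPertH ∧ nine spine estimates (0/9 proved); BetaPertH ⇐ (D1) ∧ (D4) ∧
CAP+tail; G-an2-4 gates asym, D1 and NE2/3/4.  HONEST FRAMING (cell contract, verbatim): «discharging `BetaPertH` makes Bałaban's UV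
stability UNCONDITIONAL — a real constructive-QFT result; it is NOT the continuum limit and NOT the Clay problem.»  THIS MODULE is row-sum bookkeeping
over tree theorems BY NAME (`ScalarPropagatorProjection.RT_eq_one_sub_proj144_inv`, `RT_LapSinv_divS_eq`, `grad_LapSinv_RT_eq` (file 4a);
`CovarianceRowSum.rowSum_mul_le`∕`rowSum_sub_le` (file 2); `CovarianceConstraintRowSum.rowSum_Cov_one_le_of_scalar_letters` (file 3);
`B5Adjoint130.QsOp_apply`); every analytic input — the four scalar letters — is a HYPOTHESIS displayed in the signature.  It cites nothing, mints no
`Prop`, has no `def`, 0 sorry.  NOT (T0′) (the four letters are B4's Theorem (1.10) ∕ B5 (1.110) entries for the SCALAR `G′` and B5 p. 26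
«γ₀ ≤ Q′G′²Q′* ≤ γ₁» + Combes–Thomas for `(Q′G′²Q′*)⁻¹`, each with a tree supplier on another carrier: lit-balaban `B5Ineq110GpTorus.sup_Grs_torus`∕
`sup_GrsDstar_torus` (tower `Site P k`), pv15 `B5QGGQ145*`∕`B5Torus145Decay` (multiplier model on `ℤ^{d+1}` boxes) — the index bridges to b05's
`Tor (fine n M)` are the chain's next files), NOT hslice, NOT (ASYMP), NOT D1, NOT BetaPertH, NOT continuum, NOT Clay.

ABSOLUTE RULE (cell charter, verbatim): «No internally-minted statement may enter as a cited fact. Every hypothesis is either kernel-proved in this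
package or a verbatim quotation of a PUBLISHED theorem with page reference. The manuscript(s) under audit are NOT citable for their own disputed
steps — they are the thing under adjudication; programme-internal (2001/route/tribunal) claims are never citable.»

CONTENT (`G′ := (Δ + bQ′*Q′)⁻¹`, `C := (Q′G′G′Q′*)⁻¹` written out; `b > 0` free — B5 p. 26 «e.g. a = 1»).  §1 `rowSum_one` (`‖1‖_{∞→∞} = 1`),
**`sum_norm_QsOp_row`**, **`sum_norm_QsAdj_row`** (`‖Q′‖_{∞→∞} = ‖Q′*‖_{∞→∞} = 1`); §2 **`rowSum_proj144_le`** (`Σ ‖(G′Q′*CQ′G′) x x′‖ ≤ cG′·cC·cG′`),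
**`rowSum_RT_le`** (`Σ_{x′} ‖R x x′‖ ≤ 1 + cG′·cC·cG′`); §3 **`rowSum_RT_LapSinv_divS_le`** (`cB`: `Σ_j ‖(R·Δ⁻¹·∂ᴴ) x j‖ ≤ (1 + cG′·cC·cG′)·cD`),
**`rowSum_grad_LapSinv_RT_le`** (`cA`: `Σ_{x′} ‖(∂·Δ⁻¹·R) i x′‖ ≤ cD′·(1 + cG′·cC·cG′)`); §4 (`M : Fin (d+1) → ℕ`) **`rowSum_Cov_one_le_of_Gp_letters`**:
file 3's `rowSum_Cov_one_le_of_scalar_letters` with `hA hB` DISCHARGED down to the four scalar letters `hG′ hC hD hD′`: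
`∀ i, Σ_j ‖𝒞 i j‖ ≤ cG + cD′(1 + cG′cCcG′)·(1 + cG′cCcG′)cD + cG·cC₀·cG`, `cG` (pv15) and `cC₀` (gan24) explicit as in file 3.
Unit `b2b-balaban-beta-d1-formalise-leaf-05` (gen 19), 2026-08-21; `LEAVES-FP.md` row «(T0′) CHAIN FILE 4b».  «not in print; our bookkeeping».
-/

noncomputable section

open scoped BigOperators Matrix ComplexConjugate

namespace Summit.QuantumFields.BalabanUV.Beta.FP.CovarianceScalarLetters

open Literature.MathematicalPhysics.QuantumFieldTheory.Balaban1983to89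
open Literature.MathematicalPhysics.QuantumFieldTheory.Balaban1983to89.B5Prop11Plancherel (Tor fine)
open Literature.MathematicalPhysics.QuantumFieldTheory.Balaban1983to89.B5Action121 (GradOp LapS)
open Literature.MathematicalPhysics.QuantumFieldTheory.Balaban1983to89.B5Block118 (QsOp)
open Literature.MathematicalPhysics.QuantumFieldTheory.Balaban1983to89.B5Blocks16 (blockOf QsOp_blockConst)
open Literature.MathematicalPhysics.QuantumFieldTheory.Balaban1983to89.B5Adjoint130 (QsOp_apply)
open Literature.MathematicalPhysics.QuantumFieldTheory.Balaban1983to89.B5LaplaceInverse (LapSinv)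
open Literature.MathematicalPhysics.QuantumFieldTheory.Balaban1983to89.B5Hk160Torus (QsAdj)
open Literature.MathematicalPhysics.QuantumFieldTheory.Balaban1983to89.B5Identities197Torus (RT)
open Literature.MathematicalPhysics.QuantumFieldTheory.Balaban1983to89.Beta.FluctuationProjection (Cov)
open Literature.MathematicalPhysics.QuantumFieldTheory.Balaban1983to89.B4TorusKernel (periodConst)
open Literature.MathematicalPhysics.QuantumFieldTheory.Balaban1983to89.B5G183Strip (kappa183)
open Literature.MathematicalPhysics.QuantumFieldTheory.Balaban1983to89.B5G183CovDecay (MD183)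
open Literature.MathematicalPhysics.QuantumFieldTheory.Balaban1983to89.B4Sect5Proof (latticeConst)
open Summit.QuantumFields.BalabanUV.Beta.FP.CovarianceRowSum (rowSum_mul_le rowSum_sub_le)
open Summit.QuantumFields.BalabanUV.Beta.FP.CovarianceConstraintRowSum (rowSum_Cov_one_le_of_scalar_letters)
open Summit.QuantumFields.BalabanUV.Beta.FP.ScalarPropagatorProjection (RT_eq_one_sub_proj144_inv RT_LapSinv_divS_eq grad_LapSinv_RT_eq
  DeltaP_mul_inv DeltaP_inv_conjTranspose)

/-! ## §1 Unit row sums: the identity, `Q′`, `Q′*` -/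

section Unit

/-- [folklore] `‖1‖_{∞→∞} = 1`: every row of the identity matrix has `ℓ¹` norm one. -/
theorem rowSum_one {ι : Type*} [Fintype ι] [DecidableEq ι] (i : ι) : ∑ j, ‖(1 : Matrix ι ι ℂ) i j‖ = 1 := by
  rw [Finset.sum_eq_single i (fun j _ hj => by rw [Matrix.one_apply_ne hj.symm, norm_zero]) (fun h => absurd (Finset.mem_univ i) h),
    Matrix.one_apply_eq, norm_one]

variable {d : ℕ} (n : ℕ) [NeZero n] (M : Fin d → ℕ) [hM : ∀ μ, NeZero (M μ)]

/-- [folklore] **`‖Q′‖_{∞→∞} = 1`**: the row `y` of the block average (1.20) carries the weight `n^{−d}` on the `n^d` points of `B(y)` (its entries are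
nonnegative reals and `Q′1 = 1`, `B5Blocks16.QsOp_blockConst`). -/
theorem sum_norm_QsOp_row (y : Tor M) : ∑ x, ‖QsOp n M y x‖ = 1 := by
  have h2 : ∀ x, QsOp n M y x = ((‖QsOp n M y x‖ : ℝ) : ℂ) := fun x => by
    rw [QsOp_apply]
    split_ifs <;> simp
  have h3 : ((∑ x, ‖QsOp n M y x‖ : ℝ) : ℂ) = 1 := by
    push_cast
    rw [show ∑ x, ((‖QsOp n M y x‖ : ℝ) : ℂ) = ∑ x, QsOp n M y x from Finset.sum_congr rfl fun x _ => (h2 x).symm]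
    have h := congrFun (QsOp_blockConst n M (fun _ => (1 : ℂ))) y
    simpa [Matrix.mulVec, dotProduct] using h
  exact_mod_cast h3

/-- [folklore] **`‖Q′*‖_{∞→∞} = 1`**: the row `x` of `Q′* = n^d·Q′ᴴ` is the indicator of the block of `x`. -/
theorem sum_norm_QsAdj_row (x : Tor (fine n M)) : ∑ y, ‖QsAdj n M x y‖ = 1 := by
  have hn : (n : ℝ) ≠ 0 := Nat.cast_ne_zero.mpr (NeZero.ne n)
  have h : ∀ y, ‖QsAdj n M x y‖ = if blockOf n M x = y then (1 : ℝ) else 0 := fun y => by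
    rw [QsAdj, Matrix.smul_apply, Matrix.conjTranspose_apply, QsOp_apply]
    split_ifs
    · rw [smul_eq_mul, norm_mul, norm_star, norm_div, norm_one, norm_pow, Complex.norm_natCast]
      field_simp
    · rw [star_zero, smul_zero, norm_zero]
  simp only [h, Finset.sum_ite_eq, Finset.mem_univ, if_true]

end Unit

/-! ## §2 The row-sum letter of `R` from `cG′` and `cC` via (1.44) -/

section Proj

variable {d : ℕ} (n : ℕ) [NeZero n] (M : Fin d → ℕ) [hM : ∀ μ, NeZero (M μ)] {b : ℝ} (hb : 0 < b) {cG' cC cD cD' : ℝ}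

/-- [our bookkeeping] **ROW SUMS OF THE MASSIVE PROJECTOR `G′Q′*CQ′G′`**: `≤ cG′·cC·cG′` from the row-sum letters of `G′` and `C = (Q′G′²Q′*)⁻¹`
(`‖Q′‖ = ‖Q′*‖ = 1`, `rowSum_mul_le` ×4). -/
theorem rowSum_proj144_le
    (hG' : ∀ x, ∑ x', ‖(LapS (fine n M) (n : ℂ) + (b : ℂ) • (QsAdj n M * QsOp n M))⁻¹ x x'‖ ≤ cG')
    (hC : ∀ y, ∑ y', ‖(QsOp n M * (LapS (fine n M) (n : ℂ) + (b : ℂ) • (QsAdj n M * QsOp n M))⁻¹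
      * (LapS (fine n M) (n : ℂ) + (b : ℂ) • (QsAdj n M * QsOp n M))⁻¹ * QsAdj n M)⁻¹ y y'‖ ≤ cC)
    (x : Tor (fine n M)) :
    ∑ x', ‖((LapS (fine n M) (n : ℂ) + (b : ℂ) • (QsAdj n M * QsOp n M))⁻¹ * QsAdj n M
        * (QsOp n M * (LapS (fine n M) (n : ℂ) + (b : ℂ) • (QsAdj n M * QsOp n M))⁻¹
            * (LapS (fine n M) (n : ℂ) + (b : ℂ) • (QsAdj n M * QsOp n M))⁻¹ * QsAdj n M)⁻¹
        * QsOp n M * (LapS (fine n M) (n : ℂ) + (b : ℂ) • (QsAdj n M * QsOp n M))⁻¹) x x'‖ ≤ cG' * cC * cG' := by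
  haveI : Nonempty (Tor (fine n M)) := ⟨x⟩
  haveI : Nonempty (Tor M) := ⟨fun _ => 0⟩
  have h1 := rowSum_mul_le hG' (fun x'' => (sum_norm_QsAdj_row n M x'').le)
  have h2 := rowSum_mul_le h1 hC
  have h3 := rowSum_mul_le h2 (fun y => (sum_norm_QsOp_row n M y).le)
  have h4 := rowSum_mul_le h3 hG' x
  simpa only [mul_one] using h4

include hb in
/-- [our bookkeeping] **THE ROW-SUM LETTER OF `R`**: `Σ_{x′} ‖RT x x′‖ ≤ 1 + cG′·cC·cG′` — (1.44) `R = 1 − G′Q′*CQ′G′`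
(`ScalarPropagatorProjection.RT_eq_one_sub_proj144_inv`) and §2. -/
theorem rowSum_RT_le
    (hG' : ∀ x, ∑ x', ‖(LapS (fine n M) (n : ℂ) + (b : ℂ) • (QsAdj n M * QsOp n M))⁻¹ x x'‖ ≤ cG')
    (hC : ∀ y, ∑ y', ‖(QsOp n M * (LapS (fine n M) (n : ℂ) + (b : ℂ) • (QsAdj n M * QsOp n M))⁻¹
      * (LapS (fine n M) (n : ℂ) + (b : ℂ) • (QsAdj n M * QsOp n M))⁻¹ * QsAdj n M)⁻¹ y y'‖ ≤ cC)
    (x : Tor (fine n M)) : ∑ x', ‖RT n M x x'‖ ≤ 1 + cG' * cC * cG' := by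
  rw [RT_eq_one_sub_proj144_inv n M hb]
  exact rowSum_sub_le (fun x'' => (rowSum_one x'').le) (rowSum_proj144_le n M hG' hC) x

/-! ## §3 The two coarse-projected gradient letters `cB`, `cA` -/

include hb in
/-- [our bookkeeping] **`cB` FROM SCALAR LETTERS**: `Σ_j ‖(R·Δ⁻¹·∂ᴴ) x j‖ ≤ (1 + cG′·cC·cG′)·cD` with `cD` the row-sum letter of `G′·∂ᴴ`
(`R·Δ⁻¹·∂ᴴ = R·G′·∂ᴴ`, `ScalarPropagatorProjection.RT_LapSinv_divS_eq`). -/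
theorem rowSum_RT_LapSinv_divS_le
    (hG' : ∀ x, ∑ x', ‖(LapS (fine n M) (n : ℂ) + (b : ℂ) • (QsAdj n M * QsOp n M))⁻¹ x x'‖ ≤ cG')
    (hC : ∀ y, ∑ y', ‖(QsOp n M * (LapS (fine n M) (n : ℂ) + (b : ℂ) • (QsAdj n M * QsOp n M))⁻¹
      * (LapS (fine n M) (n : ℂ) + (b : ℂ) • (QsAdj n M * QsOp n M))⁻¹ * QsAdj n M)⁻¹ y y'‖ ≤ cC)
    (hD : ∀ x, ∑ j, ‖((LapS (fine n M) (n : ℂ) + (b : ℂ) • (QsAdj n M * QsOp n M))⁻¹ * (GradOp (fine n M) (n : ℂ))ᴴ) x j‖ ≤ cD)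
    (x : Tor (fine n M)) :
    ∑ j, ‖(RT n M * LapSinv (fine n M) (n : ℂ) * (GradOp (fine n M) (n : ℂ))ᴴ) x j‖ ≤ (1 + cG' * cC * cG') * cD := by
  haveI : Nonempty (Tor (fine n M)) := ⟨x⟩
  rw [RT_LapSinv_divS_eq n M b (DeltaP_mul_inv n M hb), Matrix.mul_assoc]
  exact rowSum_mul_le (rowSum_RT_le n M hb hG' hC) hD x

include hb in
/-- [our bookkeeping] **`cA` FROM SCALAR LETTERS**: `Σ_{x′} ‖(∂·Δ⁻¹·R) i x′‖ ≤ cD′·(1 + cG′·cC·cG′)` with `cD′` the row-sum letter of `∂·G′`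
(`∂·Δ⁻¹·R = ∂·G′·R`, `ScalarPropagatorProjection.grad_LapSinv_RT_eq`). -/
theorem rowSum_grad_LapSinv_RT_le
    (hG' : ∀ x, ∑ x', ‖(LapS (fine n M) (n : ℂ) + (b : ℂ) • (QsAdj n M * QsOp n M))⁻¹ x x'‖ ≤ cG')
    (hC : ∀ y, ∑ y', ‖(QsOp n M * (LapS (fine n M) (n : ℂ) + (b : ℂ) • (QsAdj n M * QsOp n M))⁻¹
      * (LapS (fine n M) (n : ℂ) + (b : ℂ) • (QsAdj n M * QsOp n M))⁻¹ * QsAdj n M)⁻¹ y y'‖ ≤ cC)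
    (hD' : ∀ i, ∑ x', ‖(GradOp (fine n M) (n : ℂ) * (LapS (fine n M) (n : ℂ) + (b : ℂ) • (QsAdj n M * QsOp n M))⁻¹) i x'‖ ≤ cD')
    (i : Tor (fine n M) × Fin d) :
    ∑ x', ‖(GradOp (fine n M) (n : ℂ) * LapSinv (fine n M) (n : ℂ) * RT n M) i x'‖ ≤ cD' * (1 + cG' * cC * cG') := by
  haveI : Nonempty (Tor (fine n M)) := ⟨i.1⟩
  rw [grad_LapSinv_RT_eq n M b (DeltaP_mul_inv n M hb) (DeltaP_inv_conjTranspose n M)]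
  exact rowSum_mul_le hD' (rowSum_RT_le n M hb hG' hC) i

end Proj

/-! ## §4 The hard covariance's row-sum letter from the four scalar letters (`cG`, `cC₀` explicit) -/

section CovOne

variable {d : ℕ}

/-- [our bookkeeping] **FOUR SCALAR LETTERS LEFT**: for every `N ≥ d` there are d-only `c₀ δ₀ > 0` such that for every `n ≥ 1`, every torus
`M : Fin (d+1) → ℕ`, every `b > 0` and ANY row-sum letters `cG′` (of `G′ = (Δ + bQ′*Q′)⁻¹`), `cC` (of `(Q′G′²Q′*)⁻¹`), `cD` (of `G′∂ᴴ`), `cD′` (of `∂G′`),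
every row `i` of the hard covariance satisfies
`Σ_j ‖𝒞 i j‖ ≤ cG + cD′(1 + cG′cCcG′)·((1 + cG′cCcG′)cD) + cG·cC₀·cG` with `cG = C(d,N)` (pv15) and `cC₀ = (d+1)(1 + c₀)·latticeConst(d+1, δ₀)` (gan24)
— file 3's `rowSum_Cov_one_le_of_scalar_letters` with `hA`, `hB` supplied by §3. -/
theorem rowSum_Cov_one_le_of_Gp_letters {Nn : ℕ} (hN : d + 1 ≤ Nn + 1) :
    ∃ c₀ δ₀ : ℝ, 0 < c₀ ∧ 0 < δ₀ ∧
      ∀ (n : ℕ) [NeZero n] (hn : 1 ≤ n) (M : Fin (d + 1) → ℕ) [∀ μ, NeZero (M μ)] {b : ℝ} (_hb : 0 < b) {cG' cC cD cD' : ℝ},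
        (∀ x, ∑ x', ‖(LapS (fine n M) (n : ℂ) + (b : ℂ) • (QsAdj n M * QsOp n M))⁻¹ x x'‖ ≤ cG') →
        (∀ y, ∑ y', ‖(QsOp n M * (LapS (fine n M) (n : ℂ) + (b : ℂ) • (QsAdj n M * QsOp n M))⁻¹
          * (LapS (fine n M) (n : ℂ) + (b : ℂ) • (QsAdj n M * QsOp n M))⁻¹ * QsAdj n M)⁻¹ y y'‖ ≤ cC) →
        (∀ x, ∑ j, ‖((LapS (fine n M) (n : ℂ) + (b : ℂ) • (QsAdj n M * QsOp n M))⁻¹ * (GradOp (fine n M) (n : ℂ))ᴴ) x j‖ ≤ cD) →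
        (∀ i, ∑ x', ‖(GradOp (fine n M) (n : ℂ) * (LapS (fine n M) (n : ℂ) + (b : ℂ) • (QsAdj n M * QsOp n M))⁻¹) i x'‖ ≤ cD') →
        ∀ i : Tor (fine n M) × Fin (d + 1), ∑ j, ‖Cov n hn M 1 one_pos i j‖
          ≤ (2 * Nn * 2 ^ Nn * Real.exp (1 / (2 * (d + 1))) * latticeConst (d + 1) (1 / (2 * (d + 1)))
              + (d + 1) * (MD183 (d + 1) Nn * periodConst (kappa183 (d + 1)) d * latticeConst (d + 1) (kappa183 (d + 1) / (d + 1))))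
            + (cD' * (1 + cG' * cC * cG')) * ((1 + cG' * cC * cG') * cD)
            + (2 * Nn * 2 ^ Nn * Real.exp (1 / (2 * (d + 1))) * latticeConst (d + 1) (1 / (2 * (d + 1)))
              + (d + 1) * (MD183 (d + 1) Nn * periodConst (kappa183 (d + 1)) d * latticeConst (d + 1) (kappa183 (d + 1) / (d + 1))))
              * ((d + 1) * (1 + c₀) * latticeConst (d + 1) δ₀)
              * (2 * Nn * 2 ^ Nn * Real.exp (1 / (2 * (d + 1))) * latticeConst (d + 1) (1 / (2 * (d + 1)))
              + (d + 1) * (MD183 (d + 1) Nn * periodConst (kappa183 (d + 1)) d * latticeConst (d + 1) (kappa183 (d + 1) / (d + 1)))) := by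
  obtain ⟨c₀, δ₀, hc, hδ, h⟩ := rowSum_Cov_one_le_of_scalar_letters (d := d) hN
  refine ⟨c₀, δ₀, hc, hδ, fun n _ hn M _ b hb cG' cC cD cD' hG' hC hD hD' i => ?_⟩
  exact h n hn M (rowSum_grad_LapSinv_RT_le n M hb hG' hC hD') (rowSum_RT_LapSinv_divS_le n M hb hG' hC hD) i

end CovOne

end Summit.QuantumFields.BalabanUV.Beta.FP.CovarianceScalarLetters

end
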